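import Literature.NumberTheory.EllipticCurves.FunctionFieldLPoints
import Literature.NumberTheory.EllipticCurves.WeilPairingDivisors
import HarnessLib

/-!
# Values vs. places on `K̄(E)`, `∑ ord_P(u) P = O` (Silverman, *AEC*, III.3.5 ⇒), and the genus of `E/S` is not `0`

Trunk T-ELLARITH (group G16); notion `cm_endomorphisms_isogeny`. A *proofs* file (D-0014:
everything here is proved, no new definitions) on the way to the named fact
`WeierstrassCurve.exists_isogeny_ker_eq_and_comp_eq_nsmul` of
`Literature.NumberTheory.EllipticCurves.IsogenyQuotient` (Silverman, *AEC*, Prop. III.4.12: the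
quotient isogeny `E → E/S` by a finite subgroup `S`), the geometric input `hquot` of Tate's
theorem for elliptic curves over finite fields
(`Literature.AlgebraicGeometry.Motives.FaltingsECTateMainTheoremProofs`). The quotient `E/S` will
be constructed from the fixed field `K̄(E)^S` of the translations `τ_s^*`, `s ∈ S` (the tree's
`WeierstrassCurve.transAlgHom` of `FunctionFieldTranslation`, acting on places by
`ord_P(τ_T^* u) = ord_{P+T}(u)`, the tree's `WeierstrassCurve.ord_transAlgHom` of
`WeilPairingDivisors`). This file supplies three pieces of the theory of zeros and poles on `E`
(the tree's point-indexed places `placeValuation`, `ord`, `placeRes` of `WeierstrassPlaces`) on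
which that construction rests:

* **The dictionary values ↔ places** — `WeierstrassCurve.HasValueAt.placeValuation_le_one_and_placeRes_eq`:
  if `z ∈ K̄(E)` has value `c` at an affine point `P` in the sense of `FunctionFieldTranslation`
  (`z = g/h`, `h(P) ≠ 0`, `c = g(P)/h(P)`), then `v_P(z) ≤ 1` and the residue `placeRes_P(z)` is
  `c`; with the order corollaries (`HasValueAt.ord_eq_zero` for `c ≠ 0`, `HasValueAt.ord_pos` for
  `c = 0`, `HasValueAt.ord_sub_algebraMap_pos`: `z - z(P)` vanishes at `P`).
* **Silverman, *AEC*, Cor. III.3.5, direction ⇒** — `WeierstrassCurve.finsum_ord_smul_eq_zero`: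
  for `u ∈ K̄(E)^×`, `∑_P ord_P(u) • P = O` in the group `E(K̄)` ("`div u = Σ n_P (P)` ⇒
  `Σ [n_P] P = O`"), from the tree's converse `WeierstrassCurve.exists_ord_eq` and
  `eq_zero_of_ord_eq_single` (`WeilPairingDivisors`): with `Q = Σ ord_P(u) P`, the divisor
  `div u - (Q) + (O)` has degree `0` and sum `O`, so it is some `div g`, and then
  `div (u/g) = (Q) - (O)` forces `Q = O`.
* **The key lemma towards `E/S`** — `WeierstrassCurve.not_simplePoleOrbit`: for a finite subgroup
  `S ⊆ E(K̄)`, no function fixed by all `τ_s^*`, `s ∈ S`, has polar divisor a single orbit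
  `Σ_{s ∈ S} (R + s)` with multiplicity one. (For `P₀ ∉ R + S` the divisor of `h - h(P₀)` is then
  forced to be `Σ_s (P₀ + s) - Σ_s (R + s)` — the zero set is `S`-stable with `S`-invariant
  multiplicities of total mass `#S` — so `#S · (P₀ - R) = O` by III.3.5, for every `P₀` in the
  infinite set `E(K̄) ∖ (R + S)`; but `R + S + E[#S]` is finite.) Equivalently `K̄(E)^S` is not a
  rational function field: this replaces the genus computation `g(E/S) = 1` (Hurwitz, *AEC*
  II.5.9) in the construction of the quotient curve.

Besides, generic order calculus on `k(V)` (`namespace Literature.WeierstrassFunctionField`, any elliptic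
`V` over a field `k`): `ord` vs `placeValuation` inequalities, the strict triangle inequality
(`ord_add_eq_left_of_lt`, `ord_sum_eq_of_lt`, `le_ord_sum`), **linear independence of functions
with distinct orders** (`eq_zero_of_sum_smul_eq_zero_of_ord_injective`), **leading coefficients**
(`exists_ord_sub_smul_gt`: if `ord_P u = ord_P w` then `ord_P(u - c w) > ord_P w` for the
residue `c` of `u/w`), regular functions (`exists_algebraMap_eq_of_forall_placeValuation_le_one`:
integral at all affine places ⇒ in `k[V]`, Mathlib's `mem_integers_of_valuation_le_one`;
`exists_eq_algebraMap_of_forall_placeValuation_le_one`: no poles ⇒ constant, *AEC* II.1.2) and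
the parity gap **`deg N(w) ≠ 1`** (`normDeg_ne_one`, `ord_zero_ne_neg_one_of_forall`: no function
regular on the affine curve has a simple pole at `O`; Silverman, proof of Prop. III.3.1).

## References

* [SilvermanAEC2009] J. H. Silverman, *The Arithmetic of Elliptic Curves*, 2nd ed., GTM 106,
  Springer 2009: II.§1–2 (`ord_P`, Prop. II.1.1, II.1.2), II.§3 and III.§3 (divisors,
  Prop. III.3.1, **Cor. III.3.5**), III.3.6 (`τ_T`), Prop. III.4.12 (the quotient by a finite
  subgroup), II.5.9 (Hurwitz).

## Design

`noncomputable section`, `open scoped Classical`; the generic part in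
`namespace Literature.WeierstrassFunctionField` continuing `WeierstrassPlaces`/`FunctionFieldLPoints`, the
part about `K̄(E)` in `namespace WeierstrassCurve` over `K̄ = AlgebraicClosure K` as
`FunctionFieldTranslation`/`WeilPairingDivisors`, with orders written
`ord (W.baseChange (AlgebraicClosure K)).toAffine P u` as there. No definitions.
-/

noncomputable section


open scoped Classical WithZero
open scoped Polynomial.Bivariate
open Polynomial IsDedekindDomain

universe u

/-! ## Generic order calculus on `k(V)` -/

namespace Literature.NumberTheory.EllipticCurves.WeierstrassFunctionField

open WeierstrassCurve

variable {k : Type u} [Field k] {V : WeierstrassCurve.Affine k} [V.IsElliptic]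

/-- `v_P(u) ≤ 1 ↔ 0 ≤ ord_P(u)` for `u ≠ 0`. [folklore] -/
theorem placeValuation_le_one_iff_ord_nonneg (P : V.Point) {u : V.FunctionField} (hu : u ≠ 0) :
    placeValuation V P u ≤ 1 ↔ 0 ≤ ord V P u := by
  rw [placeValuation_eq_exp_neg_ord P hu, ← WithZero.exp_zero, WithZero.exp_le_exp]
  omega

/-- `v_P(u) < 1 ↔ 0 < ord_P(u)` for `u ≠ 0`. [folklore] -/
theorem placeValuation_lt_one_iff_ord_pos (P : V.Point) {u : V.FunctionField} (hu : u ≠ 0) :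
    placeValuation V P u < 1 ↔ 0 < ord V P u := by
  rw [placeValuation_eq_exp_neg_ord P hu, ← WithZero.exp_zero, WithZero.exp_lt_exp]
  omega

/-- `1 < v_P(u) ↔ ord_P(u) < 0` for `u ≠ 0` (poles). [folklore] -/
theorem one_lt_placeValuation_iff_ord_neg (P : V.Point) {u : V.FunctionField} (hu : u ≠ 0) :
    1 < placeValuation V P u ↔ ord V P u < 0 := by
  rw [placeValuation_eq_exp_neg_ord P hu, ← WithZero.exp_zero, WithZero.exp_lt_exp]
  omega

/-- `v_P(u) ≤ v_P(w) ↔ ord_P(w) ≤ ord_P(u)` for `u, w ≠ 0`. [folklore] -/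
theorem placeValuation_le_iff_ord_le (P : V.Point) {u w : V.FunctionField} (hu : u ≠ 0)
    (hw : w ≠ 0) : placeValuation V P u ≤ placeValuation V P w ↔ ord V P w ≤ ord V P u := by
  rw [placeValuation_eq_exp_neg_ord P hu, placeValuation_eq_exp_neg_ord P hw, WithZero.exp_le_exp]
  omega

/-- `v_P(u) < v_P(w) ↔ ord_P(w) < ord_P(u)` for `u, w ≠ 0`. [folklore] -/
theorem placeValuation_lt_iff_ord_lt (P : V.Point) {u w : V.FunctionField} (hu : u ≠ 0)
    (hw : w ≠ 0) : placeValuation V P u < placeValuation V P w ↔ ord V P w < ord V P u := by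
  rw [placeValuation_eq_exp_neg_ord P hu, placeValuation_eq_exp_neg_ord P hw, WithZero.exp_lt_exp]
  omega

/-- `ord_P(-u) = ord_P(u)`. [folklore] -/
theorem ord_neg (P : V.Point) (u : V.FunctionField) : ord V P (-u) = ord V P u := by
  rw [ord, ord, Valuation.map_neg]

/-- `ord_P(u ^ n) = n • ord_P(u)`. [folklore] -/
theorem ord_pow (P : V.Point) {u : V.FunctionField} (hu : u ≠ 0) (n : ℕ) :
    ord V P (u ^ n) = n * ord V P u := by
  induction n with
  | zero => simp [ord]
  | succ n ih => rw [pow_succ, ord_mul P (pow_ne_zero n hu) hu, ih]; push_cast; ring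

/-- **Strict triangle inequality**: `ord_P(u + w) = ord_P(u)` if `ord_P(u) < ord_P(w)`.
[folklore] -/
theorem ord_add_eq_left_of_lt (P : V.Point) {u w : V.FunctionField} (hu : u ≠ 0)
    (h : w = 0 ∨ ord V P u < ord V P w) : ord V P (u + w) = ord V P u := by
  rcases eq_or_ne w 0 with rfl | hw
  · rw [add_zero]
  have hlt : ord V P u < ord V P w := h.resolve_left hw
  have hv : placeValuation V P w < placeValuation V P u :=
    (placeValuation_lt_iff_ord_lt P hw hu).mpr hlt
  have := Valuation.map_add_eq_of_lt_left (placeValuation V P) hv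
  have huw : u + w ≠ 0 := fun h0 ↦ by
    rw [h0, map_zero] at this
    exact (placeValuation_ne_zero P hu) this.symm
  rw [placeValuation_eq_exp_neg_ord P huw, placeValuation_eq_exp_neg_ord P hu,
    WithZero.exp_inj] at this
  omega

/-- `ord_P(u + w) = ord_P(w)` if `ord_P(w) < ord_P(u)`. [folklore] -/
theorem ord_add_eq_right_of_lt (P : V.Point) {u w : V.FunctionField} (hw : w ≠ 0)
    (h : u = 0 ∨ ord V P w < ord V P u) : ord V P (u + w) = ord V P w := by
  rw [add_comm]; exact ord_add_eq_left_of_lt P hw h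

/-- `ord_P(u - c) = ord_P(u)` for a constant `c` if `ord_P(u) < 0`. [folklore] -/
theorem ord_sub_algebraMap_of_neg (P : V.Point) {u : V.FunctionField} (hu : u ≠ 0)
    (h : ord V P u < 0) (c : k) : ord V P (u - algebraMap k V.FunctionField c) = ord V P u := by
  rw [sub_eq_add_neg]
  refine ord_add_eq_left_of_lt P hu ?_
  by_cases hc : c = 0
  · left; simp [hc]
  · right; rw [ord_neg, ord_algebraMap]; exact h

/-- **Triangle inequality**: `min (ord_P u) (ord_P w) ≤ ord_P(u + w)` (all three non-zero).
[folklore] -/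
theorem min_ord_le_ord_add (P : V.Point) {u w : V.FunctionField} (hu : u ≠ 0) (hw : w ≠ 0)
    (huw : u + w ≠ 0) : min (ord V P u) (ord V P w) ≤ ord V P (u + w) := by
  have := Valuation.map_add (placeValuation V P) u w
  rw [placeValuation_eq_exp_neg_ord P huw, placeValuation_eq_exp_neg_ord P hu,
    placeValuation_eq_exp_neg_ord P hw, le_max_iff, WithZero.exp_le_exp, WithZero.exp_le_exp] at this
  omega

/-- `n ≤ ord_P(Σ f i)` if `n ≤ ord_P(f i)` for every summand which is non-zero (and the sum is
non-zero). [folklore] -/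
theorem le_ord_sum {ι : Type*} (P : V.Point) (s : Finset ι) (f : ι → V.FunctionField) (n : ℤ)
    (h : ∀ i ∈ s, f i ≠ 0 → n ≤ ord V P (f i)) (hs : ∑ i ∈ s, f i ≠ 0) :
    n ≤ ord V P (∑ i ∈ s, f i) := by
  have key : placeValuation V P (∑ i ∈ s, f i) ≤ WithZero.exp (-n) := by
    refine Valuation.map_sum_le _ fun i hi ↦ ?_
    by_cases h0 : f i = 0
    · simp [h0]
    · rw [placeValuation_eq_exp_neg_ord P h0, WithZero.exp_le_exp]
      have := h i hi h0
      omega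
  rw [placeValuation_eq_exp_neg_ord P hs, WithZero.exp_le_exp] at key
  omega

/-- **A sum with a unique term of least order has that order** (Mathlib's
`Valuation.map_sum_eq_of_lt`). [folklore] -/
theorem ord_sum_eq_of_lt {ι : Type*} (P : V.Point) (s : Finset ι) (f : ι → V.FunctionField)
    {j : ι} (hj : j ∈ s) (hfj : f j ≠ 0)
    (h : ∀ i ∈ s, i ≠ j → f i = 0 ∨ ord V P (f j) < ord V P (f i)) :
    ∑ i ∈ s, f i ≠ 0 ∧ ord V P (∑ i ∈ s, f i) = ord V P (f j) := by
  have key : placeValuation V P (∑ i ∈ s, f i) = placeValuation V P (f j) := by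
    refine Valuation.map_sum_eq_of_lt _ hj fun i hi ↦ ?_
    rw [Finset.mem_sdiff, Finset.mem_singleton] at hi
    rcases h i hi.1 hi.2 with h0 | hlt
    · rw [h0, map_zero]; exact (Valuation.pos_iff _).mpr hfj
    · by_cases h0 : f i = 0
      · rw [h0, map_zero]; exact (Valuation.pos_iff _).mpr hfj
      · exact (placeValuation_lt_iff_ord_lt P h0 hfj).mpr hlt
  have hne : ∑ i ∈ s, f i ≠ 0 := fun h0 ↦ by
    rw [h0, map_zero] at key
    exact placeValuation_ne_zero P hfj key.symm
  refine ⟨hne, ?_⟩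
  rw [placeValuation_eq_exp_neg_ord P hne, placeValuation_eq_exp_neg_ord P hfj,
    WithZero.exp_inj] at key
  omega

/-- **Functions with pairwise distinct orders at a place are linearly independent**: a vanishing
`k`-linear combination of non-zero functions with distinct `ord_P` has all coefficients zero.
[folklore] -/
theorem eq_zero_of_sum_smul_eq_zero_of_ord_injective {ι : Type*} (P : V.Point) (s : Finset ι)
    (f : ι → V.FunctionField) (c : ι → k) (hf : ∀ i ∈ s, f i ≠ 0)
    (hinj : ∀ i ∈ s, ∀ i' ∈ s, ord V P (f i) = ord V P (f i') → i = i')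
    (hsum : ∑ i ∈ s, c i • f i = 0) : ∀ i ∈ s, c i = 0 := by
  by_contra hne
  push Not at hne
  -- the index of least order among those with non-zero coefficient
  set t : Finset ι := s.filter fun i ↦ c i ≠ 0 with ht
  have htne : t.Nonempty := by
    obtain ⟨i, hi, hci⟩ := hne
    exact ⟨i, Finset.mem_filter.mpr ⟨hi, hci⟩⟩
  obtain ⟨j, hjt, hjmin⟩ := t.exists_min_image (fun i ↦ ord V P (f i)) htne
  obtain ⟨hjs, hcj⟩ := Finset.mem_filter.mp hjt
  have hterm : ∀ i ∈ s, c i ≠ 0 → c i • f i ≠ 0 ∧ ord V P (c i • f i) = ord V P (f i) := by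
    intro i hi hci
    have hci' : algebraMap k V.FunctionField (c i) ≠ 0 := fun h0 ↦
      hci ((algebraMap k V.FunctionField).injective (h0.trans (map_zero _).symm))
    rw [Algebra.smul_def]
    refine ⟨mul_ne_zero hci' (hf i hi), ?_⟩
    rw [ord_mul P hci' (hf i hi), ord_algebraMap, zero_add]
  have key := ord_sum_eq_of_lt P s (fun i ↦ c i • f i) hjs (hterm j hjs hcj).1 (by
    intro i hi hij
    by_cases hci : c i = 0
    · left; simp [hci]
    · right
      rw [(hterm j hjs hcj).2, (hterm i hi hci).2]
      have hle := hjmin i (Finset.mem_filter.mpr ⟨hi, hci⟩)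
      exact lt_of_le_of_ne hle fun h ↦ hij (hinj i hi j hjs h.symm))
  exact key.1 hsum

/-- **Leading coefficients**: if `ord_P(u) = ord_P(w)` (`u, w ≠ 0`) there is a constant `c ≠ 0`
with `u = c w` or `ord_P(u - c w) > ord_P(w)` — `c` is the residue of `u / w`. [folklore] -/
theorem exists_ord_sub_smul_gt (P : V.Point) {u w : V.FunctionField} (hu : u ≠ 0) (hw : w ≠ 0)
    (h : ord V P u = ord V P w) :
    ∃ c : k, c ≠ 0 ∧ (u - algebraMap k V.FunctionField c * w = 0 ∨
      ord V P w < ord V P (u - algebraMap k V.FunctionField c * w)) := by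
  set r := u / w with hr
  have hr0 : r ≠ 0 := div_ne_zero hu hw
  have hord : ord V P r = 0 := by rw [hr, ord_div P hu hw, h, sub_self]
  have hle : placeValuation V P r ≤ 1 := (placeValuation_le_one_iff_ord_nonneg P hr0).mpr hord.ge
  set c := placeRes V P r with hc
  have hlt := placeValuation_sub_placeRes_lt_one P hle
  have hc0 : c ≠ 0 := by
    intro h0
    rw [← hc, h0, map_zero, sub_zero, placeValuation_lt_one_iff_ord_pos P hr0] at hlt
    omega
  refine ⟨c, hc0, ?_⟩
  have hfac : u - algebraMap k V.FunctionField c * w = w * (r - algebraMap k V.FunctionField c) := by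
    rw [hr]; field_simp
  by_cases h0 : r - algebraMap k V.FunctionField c = 0
  · left; rw [hfac, h0, mul_zero]
  · right
    rw [← hc, placeValuation_lt_one_iff_ord_pos P h0] at hlt
    rw [hfac, ord_mul P hw h0]
    omega

/-- Variant: if `ord_P(w) ≤ ord_P(u)` (`w ≠ 0`) there is a constant `c` (possibly `0`) with
`u = c w` or `ord_P(u - c w) > ord_P(w)`. [folklore] -/
theorem exists_ord_sub_smul_gt_of_le (P : V.Point) {u w : V.FunctionField} (hw : w ≠ 0)
    (h : u = 0 ∨ ord V P w ≤ ord V P u) :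
    ∃ c : k, u - algebraMap k V.FunctionField c * w = 0 ∨
      ord V P w < ord V P (u - algebraMap k V.FunctionField c * w) := by
  rcases eq_or_ne u 0 with rfl | hu
  · exact ⟨0, Or.inl (by simp)⟩
  rcases (h.resolve_left hu).lt_or_eq with hlt | heq
  · exact ⟨0, Or.inr (by simpa using hlt)⟩
  · obtain ⟨c, -, hc⟩ := exists_ord_sub_smul_gt P hu hw heq.symm
    exact ⟨c, hc⟩

/-! ## Regular functions: integrality, constants, the parity of `ord_O` -/

/-- **A function regular at every affine point is a regular function**: `u ∈ k[V]`
(`k[V]` is Dedekind and its height-one primes are the ideals of points, `k` algebraically closed).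
Silverman, *AEC*, I.§1 / II.§1. [folklore] -/
theorem exists_algebraMap_eq_of_forall_placeValuation_le_one [IsAlgClosed k] {u : V.FunctionField}
    (h : ∀ (a b : k) (hab : V.Nonsingular a b), placeValuation V (.some a b hab) u ≤ 1) :
    ∃ w : V.CoordinateRing, algebraMap V.CoordinateRing V.FunctionField w = u := by
  have key : ∀ v : HeightOneSpectrum V.CoordinateRing, v.valuation V.FunctionField u ≤ 1 := by
    intro v
    haveI : v.asIdeal.IsMaximal := v.isPrime.isMaximal v.ne_bot
    obtain ⟨a, b, hab, hv⟩ := exists_eq_pointIdeal (V := V) v.asIdeal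
    have hns : V.Nonsingular a b := (Affine.equation_iff_nonsingular).mp hab
    have hvp : v = pointPrime hab := HeightOneSpectrum.ext (by rw [hv]; rfl)
    rw [hvp]
    exact h a b hns
  obtain ⟨w, hw⟩ := HeightOneSpectrum.mem_integers_of_valuation_le_one V.FunctionField u key
  exact ⟨w, hw⟩

omit [V.IsElliptic] in
/-- `deg N(w) = 0` forces `w` to be a constant (`w = p + q y` has
`deg N w = max (2 deg p, 2 deg q + 3)`). [folklore] -/
theorem exists_eq_algebraMap_of_normDeg_eq_zero {w : V.CoordinateRing} (hw : w ≠ 0)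
    (h : normDeg V w = 0) : ∃ c : k, w = algebraMap k V.CoordinateRing c := by
  obtain ⟨p, q, rfl⟩ := Affine.CoordinateRing.exists_smul_basis_eq w
  have hpq : p ≠ 0 ∨ q ≠ 0 := by
    by_contra h0
    push Not at h0
    obtain ⟨rfl, rfl⟩ := h0
    simp at hw
  have key := normDeg_smul_basis_eq (V' := V) p q hpq
  rw [h] at key
  have hq : q = 0 := by
    by_contra hq
    rw [if_neg hq] at key
    by_cases hp : p = 0
    · rw [if_pos hp] at key; omega
    · rw [if_neg hp] at key; omega
  subst hq
  rw [if_pos rfl] at key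
  have hp0 : p ≠ 0 := by tauto
  have hp : p.natDegree = 0 := by omega
  obtain ⟨c, rfl⟩ : ∃ c, p = C c := ⟨_, eq_C_of_natDegree_eq_zero hp⟩
  refine ⟨c, ?_⟩
  rw [zero_smul, add_zero, Algebra.smul_def, mul_one,
    IsScalarTower.algebraMap_apply k k[X] V.CoordinateRing c, Polynomial.algebraMap_eq]

/-- **A function without poles is constant**: `v_P(u) ≤ 1` at every point, `O` included,
forces `u ∈ k`. Silverman, *AEC*, II.1.2. [folklore] -/
theorem exists_eq_algebraMap_of_forall_placeValuation_le_one [IsAlgClosed k] {u : V.FunctionField}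
    (h : ∀ P : V.Point, placeValuation V P u ≤ 1) :
    ∃ c : k, u = algebraMap k V.FunctionField c := by
  obtain ⟨w, rfl⟩ := exists_algebraMap_eq_of_forall_placeValuation_le_one (V := V)
    fun a b hab ↦ h _
  rcases eq_or_ne w 0 with rfl | hw
  · exact ⟨0, by simp⟩
  have h0 := h 0
  rw [placeValuation_zero, infValuationF_algebraMap_of_ne_zero hw, ← WithZero.exp_zero,
    WithZero.exp_le_exp] at h0
  have hdeg : normDeg V w = 0 := by omega
  obtain ⟨c, rfl⟩ := exists_eq_algebraMap_of_normDeg_eq_zero hw hdeg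
  exact ⟨c, (IsScalarTower.algebraMap_apply k V.CoordinateRing V.FunctionField c).symm⟩

/-- The same with orders: `u ≠ 0` with `ord_P(u) ≥ 0` everywhere is a (non-zero) constant.
[folklore] -/
theorem exists_eq_algebraMap_of_forall_ord_nonneg [IsAlgClosed k] {u : V.FunctionField}
    (hu : u ≠ 0) (h : ∀ P : V.Point, 0 ≤ ord V P u) :
    ∃ c : k, c ≠ 0 ∧ u = algebraMap k V.FunctionField c := by
  obtain ⟨c, rfl⟩ := exists_eq_algebraMap_of_forall_placeValuation_le_one (V := V) (u := u)
    fun P ↦ (placeValuation_le_one_iff_ord_nonneg P hu).mpr (h P)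
  exact ⟨c, fun h0 ↦ hu (by simp [h0]), rfl⟩

omit [V.IsElliptic] in
/-- **`deg N(w) ≠ 1`**: `max (2 deg p, 2 deg q + 3)` is never `1`. Hence no regular function has
a simple pole at `O` — the genus of `V` is not `0`. Silverman, *AEC*, proof of Prop. III.3.1
(the functions `1, x, y, x², …` with pole orders `0, 2, 3, 4, …`). [folklore] -/
theorem normDeg_ne_one {w : V.CoordinateRing} (hw : w ≠ 0) : normDeg V w ≠ 1 := by
  obtain ⟨p, q, rfl⟩ := Affine.CoordinateRing.exists_smul_basis_eq w
  have hpq : p ≠ 0 ∨ q ≠ 0 := by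
    by_contra h0
    push Not at h0
    obtain ⟨rfl, rfl⟩ := h0
    simp at hw
  rw [normDeg_smul_basis_eq (V' := V) p q hpq]
  split_ifs <;> omega

/-- `ord_O(w) ≤ 0` for a non-zero regular function `w`. [folklore] -/
theorem ord_zero_algebraMap_nonpos {w : V.CoordinateRing} (hw : w ≠ 0) :
    ord V 0 (algebraMap V.CoordinateRing V.FunctionField w) ≤ 0 := by
  rw [ord_zero_algebraMap hw]; omega

/-- `ord_O(w) ≠ -1` for a non-zero regular function `w`. [folklore] -/
theorem ord_zero_algebraMap_ne_neg_one {w : V.CoordinateRing} (hw : w ≠ 0) :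
    ord V 0 (algebraMap V.CoordinateRing V.FunctionField w) ≠ -1 := by
  rw [ord_zero_algebraMap hw]
  have := normDeg_ne_one (V := V) hw
  omega

/-- **No function on `V` has a single simple pole at `O` and no other pole** (`u` would be
regular of `deg N = 1`). Silverman, *AEC*, Ex. 3.5 / Prop. III.3.1 (the gap at `1` in the pole
orders `0, 2, 3, …` at `O`). [folklore] -/
theorem ord_zero_ne_neg_one_of_forall [IsAlgClosed k] {u : V.FunctionField} (hu : u ≠ 0)
    (h : ∀ (a b : k) (hab : V.Nonsingular a b), 0 ≤ ord V (.some a b hab) u) :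
    ord V 0 u ≠ -1 := by
  obtain ⟨w, rfl⟩ := exists_algebraMap_eq_of_forall_placeValuation_le_one (V := V) (u := u)
    fun a b hab ↦ (placeValuation_le_one_iff_ord_nonneg _ hu).mpr (h a b hab)
  have hw : w ≠ 0 := by rintro rfl; simp at hu
  exact ord_zero_algebraMap_ne_neg_one hw

/-- Dually, **no function has `ord ≥ 0` at all affine points and `ord_O = 1`**: a regular function
does not vanish at `O`. [folklore] -/
theorem ord_zero_ne_one_of_forall [IsAlgClosed k] {u : V.FunctionField} (hu : u ≠ 0)
    (h : ∀ (a b : k) (hab : V.Nonsingular a b), 0 ≤ ord V (.some a b hab) u) :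
    ord V 0 u ≤ 0 := by
  obtain ⟨w, rfl⟩ := exists_algebraMap_eq_of_forall_placeValuation_le_one (V := V) (u := u)
    fun a b hab ↦ (placeValuation_le_one_iff_ord_nonneg _ hu).mpr (h a b hab)
  have hw : w ≠ 0 := by rintro rfl; simp at hu
  exact ord_zero_algebraMap_nonpos hw

end Literature.NumberTheory.EllipticCurves.WeierstrassFunctionField

/-! ## The dictionary between values (`HasValueAt`) and places (`placeValuation`, `placeRes`) -/

namespace WeierstrassCurve

open geomPoints Literature.NumberTheory.EllipticCurves.WeierstrassFunctionField

variable {K : Type u} [Field K] {W : WeierstrassCurve K}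

/-- The value of the regular function `mk g` at an affine point is `g(P)`. [folklore] -/
theorem pointEval_mk_equivMvPolynomial_symm {a b : AlgebraicClosure K}
    (h : (W.baseChange (AlgebraicClosure K)).toAffine.Equation a b)
    (g : MvPolynomial (Fin 2) (AlgebraicClosure K)) :
    pointEval h (Affine.CoordinateRing.mk (W.baseChange (AlgebraicClosure K)).toAffine
      ((Polynomial.Bivariate.equivMvPolynomial (AlgebraicClosure K)).symm g)) =
      MvPolynomial.eval ![a, b] g := by
  rw [pointEval_mk, eval_eq_evalEval_equivMvPolynomial_symm]

variable [W.IsElliptic]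

/-- **Values and places, I**: if `z` has value `c` at the affine point `P` (`HasValueAt`), then
`z` is integral at the place `P` with residue `c`. Silverman, *AEC*, II.§1 (`K̄[C]_P`, `M_P`,
`ord_P`, Prop. II.1.1). [folklore] -/
theorem HasValueAt.placeValuation_le_one_and_placeRes_eq {z : W.geomFunctionField}
    {P : W.geomPoints} {c : AlgebraicClosure K} (hP : P ≠ 0) (hz : W.HasValueAt z P c) :
    placeValuation (W.baseChange (AlgebraicClosure K)).toAffine P z ≤ 1 ∧
      placeRes (W.baseChange (AlgebraicClosure K)).toAffine P z = c := by
  obtain ⟨a, b, hab, rfl⟩ := geomPoints.exists_eq_some hP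
  obtain ⟨g, h, hh, hzh, hgc⟩ := hz
  rw [xy_some] at hh hgc
  rw [evalGeneric_apply, evalGeneric_apply] at hzh
  -- names for the two regular functions
  generalize hG : (Affine.CoordinateRing.mk (W.baseChange (AlgebraicClosure K)).toAffine
    ((Polynomial.Bivariate.equivMvPolynomial (AlgebraicClosure K)).symm g)) = G at hzh
  generalize hH : (Affine.CoordinateRing.mk (W.baseChange (AlgebraicClosure K)).toAffine
    ((Polynomial.Bivariate.equivMvPolynomial (AlgebraicClosure K)).symm h)) = H at hzh
  have hHval : pointEval hab.left H = MvPolynomial.eval ![a, b] h := by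
    rw [← hH, pointEval_mk_equivMvPolynomial_symm]
  have hGval : pointEval hab.left G = MvPolynomial.eval ![a, b] g := by
    rw [← hG, pointEval_mk_equivMvPolynomial_symm]
  have hvH : placeValuation (W.baseChange (AlgebraicClosure K)).toAffine (.some a b hab)
      (algebraMap _ W.geomFunctionField H) = 1 := by
    refine le_antisymm (placeValuation_some_algebraMap_le_one hab H) ?_
    by_contra hlt
    push Not at hlt
    rw [placeValuation_some_algebraMap_lt_one_iff hab, hHval] at hlt
    exact hh hlt
  have hH0 : algebraMap _ W.geomFunctionField H ≠ 0 := fun h0 ↦ by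
    rw [h0, map_zero] at hvH; exact zero_ne_one hvH
  have hz' : z = algebraMap _ W.geomFunctionField G * (algebraMap _ W.geomFunctionField H)⁻¹ := by
    rw [eq_mul_inv_iff_mul_eq₀ hH0, hzh]
  have hvG : placeValuation (W.baseChange (AlgebraicClosure K)).toAffine (.some a b hab)
      (algebraMap _ W.geomFunctionField G) ≤ 1 := placeValuation_some_algebraMap_le_one hab G
  have hvHinv : placeValuation (W.baseChange (AlgebraicClosure K)).toAffine (.some a b hab)
      (algebraMap _ W.geomFunctionField H)⁻¹ ≤ 1 := by
    rw [map_inv₀, hvH, inv_one]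
  have hresH : placeRes (W.baseChange (AlgebraicClosure K)).toAffine (.some a b hab)
      (algebraMap _ W.geomFunctionField H) ≠ 0 := by
    rw [placeRes_some_algebraMap hab, hHval]; exact hh
  refine ⟨?_, ?_⟩
  · rw [hz', map_mul, map_inv₀, hvH, inv_one, mul_one]
    exact hvG
  · rw [hz', placeRes_mul _ hvG hvHinv,
      placeRes_inv _ (placeValuation_some_algebraMap_le_one hab H) hresH,
      placeRes_some_algebraMap hab, placeRes_some_algebraMap hab, hGval, hHval, hgc,
      mul_inv_cancel_right₀ hh]

/-- **Values and places, II**: `HasValueAt z P c` gives `v_P(z) ≤ 1`. [folklore] -/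
theorem HasValueAt.placeValuation_le_one {z : W.geomFunctionField} {P : W.geomPoints}
    {c : AlgebraicClosure K} (hP : P ≠ 0) (hz : W.HasValueAt z P c) :
    placeValuation (W.baseChange (AlgebraicClosure K)).toAffine P z ≤ 1 :=
  (hz.placeValuation_le_one_and_placeRes_eq hP).1

/-- **Values and places, III**: `HasValueAt z P c` gives `placeRes_P(z) = c`. [folklore] -/
theorem HasValueAt.placeRes_eq {z : W.geomFunctionField} {P : W.geomPoints}
    {c : AlgebraicClosure K} (hP : P ≠ 0) (hz : W.HasValueAt z P c) :
    placeRes (W.baseChange (AlgebraicClosure K)).toAffine P z = c :=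
  (hz.placeValuation_le_one_and_placeRes_eq hP).2

/-- A function with a value at the affine point `P` has `ord_P ≥ 0`. [folklore] -/
theorem HasValueAt.ord_nonneg {z : W.geomFunctionField} {P : W.geomPoints}
    {c : AlgebraicClosure K} (hP : P ≠ 0) (hz : W.HasValueAt z P c) (hz0 : z ≠ 0) :
    0 ≤ ord (W.baseChange (AlgebraicClosure K)).toAffine P z :=
  (placeValuation_le_one_iff_ord_nonneg P hz0).mp (hz.placeValuation_le_one hP)

/-- A function with a **non-zero** value at `P` is a unit at `P`: `ord_P = 0`. [folklore] -/
theorem HasValueAt.ord_eq_zero {z : W.geomFunctionField} {P : W.geomPoints}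
    {c : AlgebraicClosure K} (hP : P ≠ 0) (hz : W.HasValueAt z P c) (hc : c ≠ 0) :
    ord (W.baseChange (AlgebraicClosure K)).toAffine P z = 0 := by
  obtain ⟨hle, hres⟩ := hz.placeValuation_le_one_and_placeRes_eq hP
  have h1 := placeValuation_eq_one_of_placeRes_ne_zero P hle (hres ▸ hc)
  rw [ord, h1, WithZero.log_one, neg_zero]

/-- A non-zero function with value `0` at `P` vanishes there to positive order. [folklore] -/
theorem HasValueAt.ord_pos {z : W.geomFunctionField} {P : W.geomPoints} (hP : P ≠ 0)
    (hz : W.HasValueAt z P 0) (hz0 : z ≠ 0) :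
    0 < ord (W.baseChange (AlgebraicClosure K)).toAffine P z := by
  obtain ⟨hle, hres⟩ := hz.placeValuation_le_one_and_placeRes_eq hP
  have hlt := placeValuation_sub_placeRes_lt_one P hle
  rw [hres, map_zero, sub_zero] at hlt
  exact (placeValuation_lt_one_iff_ord_pos P hz0).mp hlt

/-- **Poles from values**: if `z⁻¹` has value `0` at `P` then `z` has a pole at `P`
(`ord_P z < 0`). [folklore] -/
theorem HasValueAt.ord_neg_of_inv {z : W.geomFunctionField} {P : W.geomPoints} (hP : P ≠ 0)
    (hz : W.HasValueAt z⁻¹ P 0) (hz0 : z ≠ 0) :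
    ord (W.baseChange (AlgebraicClosure K)).toAffine P z < 0 := by
  have := hz.ord_pos hP (inv_ne_zero hz0)
  rw [ord_inv] at this
  omega

/-- The order of `z - z(P)` at `P` is positive: **a function minus its value vanishes at the
point.** [folklore] -/
theorem HasValueAt.ord_sub_algebraMap_pos {z : W.geomFunctionField} {P : W.geomPoints}
    {c : AlgebraicClosure K} (hP : P ≠ 0) (hz : W.HasValueAt z P c)
    (hne : z ≠ algebraMap (AlgebraicClosure K) W.geomFunctionField c) :
    0 < ord (W.baseChange (AlgebraicClosure K)).toAffine P
      (z - algebraMap (AlgebraicClosure K) W.geomFunctionField c) := by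
  have h0 : W.HasValueAt (z - algebraMap (AlgebraicClosure K) W.geomFunctionField c) P 0 := by
    simpa using hz.sub (hasValueAt_algebraMap c P)
  exact h0.ord_pos hP (sub_ne_zero.mpr hne)

end WeierstrassCurve

/-! ## Silverman, *AEC*, Cor. III.3.5, direction ⇒: `∑ ord_P(u) • P = O` -/

namespace WeierstrassCurve

open geomPoints Literature.NumberTheory.EllipticCurves.WeierstrassFunctionField

variable {K : Type u} [Field K] {W : WeierstrassCurve K} [W.IsElliptic]

/-- **Silverman, *AEC*, Cor. III.3.5 (⇒): for `u ∈ K̄(E)^×`, `∑_P ord_P(u) • P = O` in `E(K̄)`**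
— if `div u = Σ n_P (P)` then `Σ [n_P] P = O`. From the tree's converse
`WeierstrassCurve.exists_ord_eq` (`WeilPairingDivisors`: a degree-`0` divisor with sum `O` is
principal) and `eq_zero_of_ord_eq_single` (`(Q) - (O)` is not principal for `Q ≠ O`): with
`Q = Σ ord_P(u) P`, the divisor `div u - (Q) + (O)` is some `div g`, and `div (u/g) = (Q) - (O)`.
[cite: SilvermanAEC2009, Cor. III.3.5] -/
theorem finsum_ord_smul_eq_zero {u : W.geomFunctionField} (hu : u ≠ 0) :
    ∑ᶠ P : W.geomPoints, ord (W.baseChange (AlgebraicClosure K)).toAffine P u • P = 0 := by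
  classical
  have hfin : (Function.support fun P : W.geomPoints ↦
      ord (W.baseChange (AlgebraicClosure K)).toAffine P u).Finite :=
    finite_support_ord (V := (W.baseChange (AlgebraicClosure K)).toAffine) hu
  set D : W.geomPoints →₀ ℤ := Finsupp.ofSupportFinite _ hfin with hDdef
  have hD : ∀ P, D P = ord (W.baseChange (AlgebraicClosure K)).toAffine P u := fun P ↦ by
    rw [hDdef, Finsupp.ofSupportFinite_coe]
  set Q : W.geomPoints := ∑ᶠ P : W.geomPoints, ord (W.baseChange (AlgebraicClosure K)).toAffine P u • P
    with hQdef
  -- `∑ᶠ` as `Finsupp.sum`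
  have hsuppsub : (Function.support fun P : W.geomPoints ↦
      ord (W.baseChange (AlgebraicClosure K)).toAffine P u • P) ⊆ D.support := by
    intro P hP
    rw [Function.mem_support] at hP
    rw [Finset.mem_coe, Finsupp.mem_support_iff, hD]
    intro h0; exact hP (by rw [h0, zero_smul])
  have hQsum : Q = D.sum fun P n ↦ n • P := by
    rw [hQdef, finsum_eq_sum_of_support_subset _ hsuppsub, Finsupp.sum]
    exact Finset.sum_congr rfl fun P _ ↦ by rw [hD]
  have hdeg : (D.sum fun _ n ↦ n) = 0 := by
    have hfo : ∑ᶠ P : W.geomPoints, ord (W.baseChange (AlgebraicClosure K)).toAffine P u = 0 :=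
      finsum_ord (V := (W.baseChange (AlgebraicClosure K)).toAffine) hu
    rw [Finsupp.sum, ← hfo, finsum_eq_sum_of_support_subset (s := D.support) _ (by
      intro P hP
      rw [Finset.mem_coe, Finsupp.mem_support_iff, hD]; exact hP)]
    exact Finset.sum_congr rfl fun P _ ↦ hD P
  by_contra hQ0
  -- the divisor `div u - (Q) + (O)` has degree `0` and sum `O`
  set D' : W.geomPoints →₀ ℤ := D - Finsupp.single Q 1 + Finsupp.single 0 1 with hD'
  have hdeg' : (D'.sum fun _ n ↦ n) = 0 := by
    rw [hD', Finsupp.sum_add_index' (h := fun _ n ↦ n) (fun _ ↦ rfl) (fun _ _ _ ↦ rfl),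
      Finsupp.sum_sub_index (h := fun _ n ↦ n) (fun _ _ _ ↦ rfl),
      Finsupp.sum_single_index (h := fun _ n ↦ n) rfl,
      Finsupp.sum_single_index (h := fun _ n ↦ n) rfl, hdeg]
    ring
  have hsum' : (D'.sum fun P n ↦ n • P) = 0 := by
    rw [hD', Finsupp.sum_add_index' (h := fun P n ↦ n • P) (fun _ ↦ zero_smul _ _)
        (fun _ _ _ ↦ add_smul _ _ _),
      Finsupp.sum_sub_index (h := fun P n ↦ n • P) (fun _ _ _ ↦ sub_smul _ _ _),
      Finsupp.sum_single_index (h := fun P n ↦ n • P) (zero_smul _ _),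
      Finsupp.sum_single_index (h := fun P n ↦ n • P) (zero_smul _ _), ← hQsum, one_smul, smul_zero,
      sub_self, zero_add]
  obtain ⟨g, hg0, hg⟩ := exists_ord_eq D' hdeg' hsum'
  have key : ∀ P : W.geomPoints, P ≠ 0 →
      ord (W.baseChange (AlgebraicClosure K)).toAffine P (u / g) = if P = Q then 1 else 0 := by
    intro P hP
    rw [ord_div P hu hg0, hg P, hD']
    simp only [Finsupp.coe_add, Finsupp.coe_sub, Pi.add_apply, Pi.sub_apply, hD,
      Finsupp.single_apply, if_neg (Ne.symm hP)]
    by_cases hPQ : P = Q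
    · rw [if_pos hPQ.symm, if_pos hPQ]; ring
    · rw [if_neg (Ne.symm hPQ), if_neg hPQ]; ring
  exact hQ0 (eq_zero_of_ord_eq_single (div_ne_zero hu hg0) key)

/-- **Divisors of `S`-invariant functions are `S`-invariant**: if `τ_T^* z = z` then
`ord_{P+T}(z) = ord_P(z)` (the tree's `ord_transAlgHom`). [folklore] -/
theorem ord_add_eq_of_transAlgHom_eq {T : W.geomPoints} {z : W.geomFunctionField}
    (h : W.transAlgHom T z = z) (P : W.geomPoints) :
    ord (W.baseChange (AlgebraicClosure K)).toAffine (P + T) z =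
      ord (W.baseChange (AlgebraicClosure K)).toAffine P z := by
  rw [← ord_transAlgHom, h]

end WeierstrassCurve

/-! ## The key lemma: no `S`-invariant function has a single simple orbit of poles -/

namespace WeierstrassCurve

open geomPoints Literature.NumberTheory.EllipticCurves.WeierstrassFunctionField

variable {K : Type u} [Field K] {W : WeierstrassCurve K} [W.IsElliptic]

/-- The `n`-torsion set `{P | n • P = O}` of `E(K̄)` is finite for `n ≠ 0`. [folklore] -/
theorem geomPoints.finite_setOf_nsmul_eq_zero {n : ℕ} (hn : n ≠ 0) :
    {P : W.geomPoints | n • P = 0}.Finite := by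
  haveI := WeierstrassCurve.finite_torsionBy_of_isAlgClosed
    (V := W.baseChange (AlgebraicClosure K)) (n := (n : ℤ)) (by exact_mod_cast hn)
  set Tn : AddSubgroup W.geomPoints :=
    AddSubgroup.torsionBy (W.baseChange (AlgebraicClosure K)).toAffine.Point (n : ℤ) with hTn
  have hfin : (Tn : Set W.geomPoints).Finite := Set.finite_coe_iff.mp this
  refine hfin.subset fun P hP ↦ ?_
  have hP' : n • P = 0 := hP
  change (n : ℤ) • P = 0
  rw [natCast_zsmul]
  exact hP'

/-- A finitely supported non-negative integer-valued function with `∑ᶠ ≤ 0` vanishes.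
[folklore] -/
theorem eq_zero_of_finsum_nonpos {α : Type*} {r : α → ℤ} (hfin : (Function.support r).Finite)
    (hr : ∀ a, 0 ≤ r a) (hsum : ∑ᶠ a, r a ≤ 0) (a : α) : r a = 0 := by
  have hsum' : ∑ᶠ a, r a = 0 := le_antisymm hsum (finsum_nonneg hr)
  rw [finsum_eq_sum_of_support_subset r (s := hfin.toFinset) (by simp)] at hsum'
  rw [Finset.sum_eq_zero_iff_of_nonneg (fun a _ ↦ hr a)] at hsum'
  by_cases ha : a ∈ hfin.toFinset
  · exact hsum' a ha
  · rw [Set.Finite.mem_toFinset, Function.mem_support, not_not] at ha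
    exact ha

/-- `∑ᶠ` of `c` times the indicator of a finite set is `c · card`. [folklore] -/
theorem finsum_ite_mem_const {α : Type*} (A : Finset α) (c : ℤ) :
    ∑ᶠ a, (if a ∈ A then c else 0) = A.card * c := by
  rw [finsum_eq_sum_of_support_subset _ (s := A) (by
    intro a ha
    rw [Function.mem_support] at ha
    by_contra h
    exact ha (if_neg (fun h' ↦ h (Finset.mem_coe.mpr h')))), Finset.sum_ite_mem, Finset.inter_self,
    Finset.sum_const, nsmul_eq_mul]

/-- `∑ᶠ` of `[a ∈ A] • a` is `∑_{a ∈ A} a`. [folklore] -/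
theorem finsum_ite_mem_smul_eq_sum {α : Type*} [AddCommGroup α] (A : Finset α) :
    ∑ᶠ a, (if a ∈ A then (1 : ℤ) else 0) • a = ∑ a ∈ A, a := by
  rw [finsum_eq_sum_of_support_subset _ (s := A) (by
    intro a ha
    rw [Function.mem_support] at ha
    by_contra h
    exact ha (by rw [if_neg (fun h' ↦ h (Finset.mem_coe.mpr h')), zero_smul]))]
  refine Finset.sum_congr rfl fun a ha ↦ ?_
  rw [if_pos ha, one_smul]

/-- **Key lemma.** Let `S ⊆ E(K̄)` be a finite subgroup and `h ∈ K̄(E)` a function fixed by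
the translations `τ_s^*`, `s ∈ S`. Then the polar divisor of `h` is **not** a single orbit
`R + S` with multiplicity one: it is impossible that `ord_{R+s}(h) = -1` for all `s ∈ S` and
`ord_P(h) ≥ 0` off `R + S`. (Otherwise, for every `P₀ ∉ R + S`, the function `h - h(P₀)` has
divisor exactly `Σ_s (P₀ + s) - Σ_s (R + s)` — its zero set is `S`-stable with `S`-invariant
multiplicities of total mass `#S` — whence `#S · (P₀ - R) = O` by *AEC* III.3.5; but
`R + S + E[#S]` is finite and `E(K̄)` is not.) This is the statement "`K̄(E)^S` is not a rational
function field", i.e. the genus of `E/S` is not `0`. Silverman, *AEC*, III.4.12 (the quotient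
`E/Φ` is an elliptic curve), II.5.9 (Hurwitz) for the printed route. [folklore] -/
theorem not_simplePoleOrbit {S : AddSubgroup W.geomPoints} (hS : (S : Set W.geomPoints).Finite)
    {h : W.geomFunctionField} (hh : h ≠ 0) (hinv : ∀ s ∈ S, W.transAlgHom s h = h)
    (R : W.geomPoints)
    (hpole : ∀ s ∈ S, ord (W.baseChange (AlgebraicClosure K)).toAffine (R + s) h = -1)
    (hreg : ∀ P : W.geomPoints, P - R ∉ S → 0 ≤ ord (W.baseChange (AlgebraicClosure K)).toAffine P h) :
    False := by
  classical
  set T : Finset W.geomPoints := hS.toFinset with hT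
  have hmemT : ∀ s, s ∈ T ↔ s ∈ S := fun s ↦ by rw [hT, Set.Finite.mem_toFinset, SetLike.mem_coe]
  have h0T : (0 : W.geomPoints) ∈ T := (hmemT 0).mpr S.zero_mem
  set n : ℕ := T.card with hn
  have hn0 : n ≠ 0 := Finset.card_ne_zero.mpr ⟨0, h0T⟩
  -- main claim: every `P₀ ∉ R + S` satisfies `n • (P₀ - R) = 0`
  have hmain : ∀ P₀ : W.geomPoints, P₀ - R ∉ S → n • (P₀ - R) = 0 := by
    intro P₀ hP₀
    -- the orbits `A = R + S` (poles) and `B = P₀ + S`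
    set A : Finset W.geomPoints := T.image (R + ·) with hA
    set B : Finset W.geomPoints := T.image (P₀ + ·) with hB
    have hmemA : ∀ P, P ∈ A ↔ P - R ∈ S := fun P ↦ by
      rw [hA, Finset.mem_image]
      constructor
      · rintro ⟨s, hs, rfl⟩; rw [add_sub_cancel_left]; exact (hmemT s).mp hs
      · intro hP; exact ⟨P - R, (hmemT _).mpr hP, by abel⟩
    have hmemB : ∀ P, P ∈ B ↔ P - P₀ ∈ S := fun P ↦ by
      rw [hB, Finset.mem_image]
      constructor
      · rintro ⟨s, hs, rfl⟩; rw [add_sub_cancel_left]; exact (hmemT s).mp hs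
      · intro hP; exact ⟨P - P₀, (hmemT _).mpr hP, by abel⟩
    have hAB : ∀ P, P ∈ B → P ∉ A := by
      intro P hPB hPA
      rw [hmemB] at hPB; rw [hmemA] at hPA
      exact hP₀ (by rw [show P₀ - R = (P - R) - (P - P₀) by abel]; exact S.sub_mem hPA hPB)
    have hcardA : A.card = n := by
      rw [hA, Finset.card_image_of_injective _ (add_right_injective R)]
    have hcardB : B.card = n := by
      rw [hB, Finset.card_image_of_injective _ (add_right_injective P₀)]
    -- the function `g = h - h(P₀)`
    have hvP₀ : placeValuation (W.baseChange (AlgebraicClosure K)).toAffine P₀ h ≤ 1 :=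
      (placeValuation_le_one_iff_ord_nonneg P₀ hh).mpr (hreg P₀ hP₀)
    set c := placeRes (W.baseChange (AlgebraicClosure K)).toAffine P₀ h with hc
    set g := h - algebraMap (AlgebraicClosure K) W.geomFunctionField c with hg
    have hordR : ord (W.baseChange (AlgebraicClosure K)).toAffine R h = -1 := by simpa using hpole 0 S.zero_mem
    have hg0 : g ≠ 0 := by
      intro h0
      have : h = algebraMap (AlgebraicClosure K) W.geomFunctionField c := sub_eq_zero.mp h0
      rw [this, ord_algebraMap] at hordR
      norm_num at hordR
    have hginv : ∀ s ∈ S, W.transAlgHom s g = g := fun s hs ↦ by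
      rw [hg, map_sub, hinv s hs, AlgHom.commutes]
    have hgA : ∀ P ∈ A, ord (W.baseChange (AlgebraicClosure K)).toAffine P g = -1 := by
      intro P hP
      obtain ⟨s, hs, rfl⟩ := Finset.mem_image.mp hP
      have := hpole s ((hmemT s).mp hs)
      rw [hg, ord_sub_algebraMap_of_neg _ hh (by omega) c, this]
    have hgreg : ∀ P, P ∉ A → 0 ≤ ord (W.baseChange (AlgebraicClosure K)).toAffine P g := by
      intro P hP
      rw [hmemA] at hP
      have h1 := hreg P hP
      by_cases hc0 : c = 0
      · rw [hg, hc0, map_zero, sub_zero]; exact h1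
      · rw [hg, sub_eq_add_neg]
        have hc' : -algebraMap (AlgebraicClosure K) W.geomFunctionField c ≠ 0 := by
          rw [neg_ne_zero]
          exact (_root_.map_ne_zero (algebraMap (AlgebraicClosure K) W.geomFunctionField)).mpr hc0
        have := min_ord_le_ord_add P hh hc' (by rw [← sub_eq_add_neg]; exact hg0)
        rw [ord_neg, ord_algebraMap] at this
        exact le_trans (le_min h1 le_rfl) this
    have hgP₀ : 1 ≤ ord (W.baseChange (AlgebraicClosure K)).toAffine P₀ g := by
      have := placeValuation_sub_placeRes_lt_one P₀ hvP₀
      rw [← hc, ← hg, placeValuation_lt_one_iff_ord_pos P₀ hg0] at this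
      exact this
    have hgB : ∀ P ∈ B, ord (W.baseChange (AlgebraicClosure K)).toAffine P g = ord (W.baseChange (AlgebraicClosure K)).toAffine P₀ g := by
      intro P hP
      obtain ⟨s, hs, rfl⟩ := Finset.mem_image.mp hP
      exact ord_add_eq_of_transAlgHom_eq (hginv s ((hmemT s).mp hs)) P₀
    -- the defect function `r P = ord_P g - ord_{P₀} g [P ∈ B] + [P ∈ A] ≥ 0` has `∑ᶠ r ≤ 0`
    set e : ℤ := ord (W.baseChange (AlgebraicClosure K)).toAffine P₀ g with he
    set r : W.geomPoints → ℤ := fun P ↦ ord (W.baseChange (AlgebraicClosure K)).toAffine P g -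
      (if P ∈ B then e else 0) + (if P ∈ A then 1 else 0) with hr
    have hr0 : ∀ P, 0 ≤ r P := by
      intro P
      simp only [hr]
      by_cases hPA : P ∈ A
      · rw [if_pos hPA, if_neg (fun hPB ↦ hAB P hPB hPA), hgA P hPA]; norm_num
      · rw [if_neg hPA]
        by_cases hPB : P ∈ B
        · rw [if_pos hPB, hgB P hPB]; norm_num
        · rw [if_neg hPB]; simpa using hgreg P hPA
    have hsuppg : (Function.support fun P : W.geomPoints ↦
        ord (W.baseChange (AlgebraicClosure K)).toAffine P g).Finite :=
      finite_support_ord (V := (W.baseChange (AlgebraicClosure K)).toAffine) hg0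
    have hfinA : (Function.support fun P : W.geomPoints ↦ (if P ∈ A then (1 : ℤ) else 0)).Finite :=
      (Finset.finite_toSet A).subset fun P hP ↦ by
        by_contra h; exact hP (if_neg h)
    have hfinB : (Function.support fun P : W.geomPoints ↦ (if P ∈ B then e else 0)).Finite :=
      (Finset.finite_toSet B).subset fun P hP ↦ by
        by_contra h; exact hP (if_neg h)
    have hrfin : (Function.support r).Finite := by
      refine ((hsuppg.union hfinB).union hfinA).subset fun P hP ↦ ?_
      have hP : r P ≠ 0 := hP
      simp only [Set.mem_union, Function.mem_support]
      by_contra hcon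
      push Not at hcon
      obtain ⟨⟨h1, h2⟩, h3⟩ := hcon
      exact hP (by simp only [hr, h1, h2, h3]; norm_num)
    have hrsum : ∑ᶠ P, r P = n * (1 - e) := by
      simp only [hr]
      have hfo : ∑ᶠ P : W.geomPoints, ord (W.baseChange (AlgebraicClosure K)).toAffine P g = 0 :=
        finsum_ord (V := (W.baseChange (AlgebraicClosure K)).toAffine) hg0
      rw [finsum_add_distrib ((hsuppg.union hfinB).subset (Function.support_sub _ _)) hfinA,
        finsum_sub_distrib hsuppg hfinB, hfo, finsum_ite_mem_const, finsum_ite_mem_const, hcardA, hcardB]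
      ring
    have hrle : ∑ᶠ P, r P ≤ 0 := by
      rw [hrsum]
      have : (1 : ℤ) - e ≤ 0 := by omega
      exact mul_nonpos_of_nonneg_of_nonpos (by positivity) this
    have hrzero := eq_zero_of_finsum_nonpos hrfin hr0 hrle
    -- hence `ord_{P₀} g = 1` and `ord_P g = [P ∈ B] - [P ∈ A]`
    have hone : e = 1 := by
      have h1 := le_antisymm hrle (finsum_nonneg hr0)
      rw [hrsum] at h1
      have : (1 : ℤ) - e = 0 := by
        rcases mul_eq_zero.mp h1 with h | h
        · exact absurd (by exact_mod_cast h) hn0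
        · exact h
      omega
    have hordg : ∀ P, ord (W.baseChange (AlgebraicClosure K)).toAffine P g = (if P ∈ B then 1 else 0) - (if P ∈ A then 1 else 0) := by
      intro P
      have := hrzero P
      simp only [hr, hone] at this
      omega
    -- *AEC* III.3.5: `∑ ord_P(g) P = Σ_B - Σ_A = n (P₀ - R) = O`
    have h35 : ∑ᶠ P : W.geomPoints, ord (W.baseChange (AlgebraicClosure K)).toAffine P g • P =
        (0 : W.geomPoints) := finsum_ord_smul_eq_zero hg0
    have h35' : ∑ᶠ P : W.geomPoints, ((if P ∈ B then (1 : ℤ) else 0) • P -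
        (if P ∈ A then (1 : ℤ) else 0) • P) = 0 := by
      rw [← h35]
      exact finsum_congr fun P ↦ by rw [hordg P, sub_zsmul]; rfl
    have hfB : (Function.support fun P : W.geomPoints ↦ (if P ∈ B then (1 : ℤ) else 0) • P).Finite :=
      (Finset.finite_toSet B).subset fun P hP ↦ by
        by_contra h
        exact hP (by
          show (if P ∈ B then (1 : ℤ) else 0) • P = 0
          rw [if_neg (fun h' ↦ h (Finset.mem_coe.mpr h')), zero_smul])
    have hfA : (Function.support fun P : W.geomPoints ↦ (if P ∈ A then (1 : ℤ) else 0) • P).Finite :=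
      (Finset.finite_toSet A).subset fun P hP ↦ by
        by_contra h
        exact hP (by
          show (if P ∈ A then (1 : ℤ) else 0) • P = 0
          rw [if_neg (fun h' ↦ h (Finset.mem_coe.mpr h')), zero_smul])
    rw [finsum_sub_distrib hfB hfA, finsum_ite_mem_smul_eq_sum, finsum_ite_mem_smul_eq_sum, hB, hA,
      Finset.sum_image (fun _ _ _ _ h ↦ add_right_injective P₀ h),
      Finset.sum_image (fun _ _ _ _ h ↦ add_right_injective R h),
      Finset.sum_add_distrib, Finset.sum_add_distrib, Finset.sum_const, Finset.sum_const, ← hn,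
      sub_eq_zero] at h35'
    rw [nsmul_sub, sub_eq_zero]
    exact add_right_cancel h35'
  -- conclusion: `E(K̄) ⊆ R + (S ∪ E[n])`, a finite set
  have hfin : ((fun P ↦ P + R) '' ((S : Set W.geomPoints) ∪ {P | n • P = 0})).Finite :=
    (hS.union (geomPoints.finite_setOf_nsmul_eq_zero hn0)).image _
  obtain ⟨P₀, hP₀⟩ := hfin.infinite_compl.nonempty
  apply hP₀
  refine ⟨P₀ - R, ?_, sub_add_cancel P₀ R⟩
  by_cases hmem : P₀ - R ∈ S
  · exact Or.inl hmem
  · exact Or.inr (hmain P₀ hmem)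

end WeierstrassCurve
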